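import Literature.NumberTheory.GelbartRogawski1991.LocalSplittingsDifferByCharacter     -- ★ `MpPsi.exists_character_of_proj_eq`
import HarnessLib

/-!
# Crux `H413`, programme P2, N3 road (a) — THE (S5) DICTIONARY UP TO A CHARACTER
# (a transported lawful action implementing the same symplectic maps as a metaplectic family IS that family up to a character)

Cell hodgecm-mathlib (D-0151), FLOOR 0, crux item H413 = stmt-HodgeConjecture-24833, programme P2; N3 road (a); seat A-p12 (g17), offer (o3) «=» by the K1
lead B-p18 (g28) 2026-08-31T21:25Z.  WHY: letter (a) of ★ `GelbartRogawski1991.thetaType_nonsplit_jacquetModule` is reduced (★ p834949 ∕ p835111) to ONE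
dictionary chart `(π, σ, Tr, hTr)`: the descended centre action `σ` on a Jacquet chart of `ω_v|`, carried by `Tr` to `c ⊗ ω¹(γ_v, ψ_v)` for a scalar function
`c` with `ψθ(det u) = c(u)·χ_{f,v}(u)` (★ p834861 `…_of_dictionary`; `c = μ_v⁻¹ ∘ det` is the print's value).  F0P2-p01 (g8)'s architecture (P2 STATUS
2026-08-31T20:57:46Z (V2), (E2)) produces `σ` as operators IMPLEMENTING, in the fibre Heisenberg model, the symplectic maps `u ↦ (rotation by u on 𝕎₁)`;
`ω¹` is `toRep ∘ ω` for a homomorphism `ω : E¹_v →* MpPsi ρ_line` implementing the same maps in the line model.  This file is the generic step in between: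
**if `Tr ∘ σ(·) ∘ Tr⁻¹` implements, element by element, the symplectic components of a homomorphism `ω : G →* MpPsi ρ`, and implementers of `ρ` are unique up
to scalars (★ `ImplementerUniqueUpToScalar ρ` — kernel theorem for every local Schrödinger model, ★ `implementerUniqueUpToScalar_localSchrodinger`), then
`toRep (ω g) (Tr x) = η(g) • Tr (σ g x)` for a CHARACTER `η : G →* kˣ`** — the dictionary `(Tr, c := η, hTr)` of ★ p834861, with p01's «descent character»
`ν = η · μ_v ∘ det` left to (N).  Pure algebra over a field: the transported family is packaged as a homomorphism `G →* MpPsi ρ` (MVW's `S̃p_ψ`, ★ `MpPsi`)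
and compared with `ω` by ★ `MpPsi.exists_character_of_proj_eq` (two homomorphisms into `S̃p_ψ` over the same map to `Sp` differ by a character through the
centre). [MoeglinVignerasWaldspurger1987 Chap. 2 II.1 (A)(B); GelbartRogawski1991 §3.1 Remark p. 457 L4–13, §3.2 (3.2.1) p. 457.]

WHAT IS PROVED (kernel, no `sorry`, axioms the standard trio; THEOREMS ONLY).
* `exists_mpPsi_hom_of_implements` — a representation `σ` of `G` on `S₁`, a linear isomorphism `T : S₁ ≃ S` and `γ : G →* Sp(W)` with
  `T σ(g) T⁻¹` implementing `γ g` for `ρ` give a homomorphism `s : G →* MpPsi ρ` over `γ` whose operator component is `T σ(g) T⁻¹`.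
* **`exists_character_dictionary`** — the head above (`γ := MpPsi.proj ∘ ω`).
* `exists_character_dictionary_symm` — the same read on `S₁`: `T⁻¹ (toRep (ω g) (T x)) = η(g) • σ g x`.

## References
* [MoeglinVignerasWaldspurger1987] C. Mœglin, M.-F. Vignéras, J.-L. Waldspurger, *Correspondances de Howe sur un corps p-adique*, LNM 1291 (1987):
  Chap. 2 II.1 (A), (B).
* [GelbartRogawski1991] S. Gelbart, J. Rogawski, *L-functions and Fourier–Jacobi coefficients for the unitary group U(3)*, Invent. Math. 105 (1991):
  §3.1 Remark p. 457 L4–13; §3.2 (3.2.1) p. 457.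
-/

set_option autoImplicit false
set_option linter.dupNamespace false -- the mandated namespace repeats the single-problem summit's segment

noncomputable section

open Literature.RepresentationTheory.HeisenbergGroup

namespace Summit.HodgeConjecture.HodgeConjecture.Cruxes.H413.F0P2oDictionaryUpToCharacter

variable {R : Type*} [CommRing R] [Invertible (2 : R)] {V : Type*} [AddCommGroup V] [Module R V] {B : V →ₗ[R] V →ₗ[R] R}
variable {k : Type*} [Field k] {S S₁ : Type*} [AddCommGroup S] [Module k S] [AddCommGroup S₁] [Module k S₁]
universe uG

variable (ρ : Representation k (Heisenberg B) S) {G : Type uG} [Group G]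

/-- **a transported lawful action implementing `γ` is a homomorphism into `S̃p_ψ` over `γ`**: for a representation `σ` of `G` on `S₁`, `T : S₁ ≃ₗ S` and
`γ : G →* Sp(W)` such that each `T σ(g) T⁻¹` satisfies MVW's condition (A) for `γ g` (`himpl`, written pointwise at `f = T x`), there is `s : G →* MpPsi ρ` with
`proj (s g) = γ g` and operator component `T σ(g) T⁻¹` (`(s g).2 (T x) = T (σ g x)`). [cite: MoeglinVignerasWaldspurger1987, Chap. 2 II.1 (A)] -/
theorem exists_mpPsi_hom_of_implements (σ : Representation k G S₁) (T : S₁ ≃ₗ[k] S) (γ : G →* symplecticGroup B)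
    (himpl : ∀ (g : G) (h : Heisenberg B) (x : S₁), T (σ g (T.symm (ρ h (T x)))) = ρ ((ofSymplectic B (γ g)).act h) (T (σ g x))) :
    ∃ s : G →* MpPsi ρ, ∀ g : G, MpPsi.proj ρ (s g) = γ g ∧
      ∀ x : S₁, ((s g : MpPsi ρ) : symplecticGroup B × (S ≃ₗ[k] S)).2 (T x) = T (σ g x) := by
  -- the transported operators as linear automorphisms of `S`
  let E : G → (S ≃ₗ[k] S) := fun g =>
    T.symm.trans ((LinearMap.GeneralLinearGroup.generalLinearEquiv k S₁ (σ.asGroupHom g)).trans T)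
  have hE : ∀ (g : G) (y : S), E g y = T (σ g (T.symm y)) := fun g y => rfl
  have hmem : ∀ g : G, ((γ g, E g) : symplecticGroup B × (S ≃ₗ[k] S)) ∈ MpPsi ρ := fun g => by
    rw [mem_MpPsi]
    intro h f
    obtain ⟨x, rfl⟩ := T.surjective f
    show E g (ρ h (T x)) = ρ ((ofSymplectic B (γ g)).act h) (E g (T x))
    rw [hE, hE, LinearEquiv.symm_apply_apply, himpl]
  have hone : (⟨(γ 1, E 1), hmem 1⟩ : MpPsi ρ) = 1 :=
    Subtype.ext (Prod.ext (show γ 1 = 1 from map_one γ) (LinearEquiv.ext fun y => by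
      show E 1 y = y
      rw [hE, map_one, Module.End.one_apply, LinearEquiv.apply_symm_apply]))
  have hmul : ∀ a b : G, (⟨(γ (a * b), E (a * b)), hmem (a * b)⟩ : MpPsi ρ) = ⟨(γ a, E a), hmem a⟩ * ⟨(γ b, E b), hmem b⟩ := fun a b =>
    Subtype.ext (Prod.ext (show γ (a * b) = γ a * γ b from map_mul γ a b) (LinearEquiv.ext fun y => by
      show E (a * b) y = E a (E b y)
      rw [hE, hE, hE, LinearEquiv.symm_apply_apply, map_mul, Module.End.mul_apply]))
  refine ⟨{ toFun := fun g => ⟨(γ g, E g), hmem g⟩, map_one' := hone, map_mul' := hmul }, fun g => ⟨rfl, fun x => ?_⟩⟩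
  show E g (T x) = T (σ g x)
  rw [hE, LinearEquiv.symm_apply_apply]

variable [Nontrivial S]

/-- **THE DICTIONARY UP TO A CHARACTER.**  Let `ω : G →* MpPsi ρ` be a metaplectic family for a Heisenberg model `ρ` whose implementers are unique up to
scalars (`hU`), `σ` a representation of `G` on `S₁` and `T : S₁ ≃ₗ[k] S` such that every `T σ(g) T⁻¹` implements the symplectic component of `ω g`
(`himpl`).  Then **`toRep (ω g) (T x) = η(g) • T (σ g x)` for a character `η : G →* kˣ`** — `T` carries `σ` to the scalar twist `η ⊗ (toRep ∘ ω)`, the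
shape `hTr` of ★ p834861 `F0P2oThetaTypeJacquetWeightSpaceOfDictionary.nonempty_jacquet_xThetaGqsCM_equiv_weightSpace_of_dictionary`.
[cite: MoeglinVignerasWaldspurger1987, Chap. 2 II.1 (B)] [cite: GelbartRogawski1991, §3.1 Remark p. 457 L4–13] -/
theorem exists_character_dictionary (σ : Representation k G S₁) (T : S₁ ≃ₗ[k] S) (ω : G →* MpPsi ρ) (hU : ImplementerUniqueUpToScalar ρ)
    (himpl : ∀ (g : G) (h : Heisenberg B) (x : S₁),
      T (σ g (T.symm (ρ h (T x)))) = ρ ((ofSymplectic B (MpPsi.proj ρ (ω g))).act h) (T (σ g x))) :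
    ∃ η : G →* kˣ, ∀ (g : G) (x : S₁), MpPsi.toRep ρ (ω g) (T x) = ((η g : kˣ) : k) • T (σ g x) := by
  obtain ⟨s, hs⟩ := exists_mpPsi_hom_of_implements ρ σ T ((MpPsi.proj ρ).comp ω) himpl
  obtain ⟨η, hη⟩ := MpPsi.exists_character_of_proj_eq ρ hU s ω fun g => ((hs g).1).symm
  refine ⟨η, fun g x => ?_⟩
  rw [MpPsi.toRep_apply, hη g, Subgroup.coe_mul, Prod.snd_mul, LinearEquiv.mul_apply, (hs g).2 x, MpPsi.coe_ofScalar, scalarOp_apply]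

/-- the same identity read on `S₁`: `T⁻¹ (toRep (ω g) (T x)) = η(g) • σ g x`. [cite: MoeglinVignerasWaldspurger1987, Chap. 2 II.1 (B)] -/
theorem exists_character_dictionary_symm (σ : Representation k G S₁) (T : S₁ ≃ₗ[k] S) (ω : G →* MpPsi ρ) (hU : ImplementerUniqueUpToScalar ρ)
    (himpl : ∀ (g : G) (h : Heisenberg B) (x : S₁),
      T (σ g (T.symm (ρ h (T x)))) = ρ ((ofSymplectic B (MpPsi.proj ρ (ω g))).act h) (T (σ g x))) :
    ∃ η : G →* kˣ, ∀ (g : G) (x : S₁), T.symm (MpPsi.toRep ρ (ω g) (T x)) = ((η g : kˣ) : k) • σ g x := by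
  obtain ⟨η, hη⟩ := exists_character_dictionary ρ σ T ω hU himpl
  exact ⟨η, fun g x => by rw [hη, map_smul, LinearEquiv.symm_apply_apply]⟩

end Summit.HodgeConjecture.HodgeConjecture.Cruxes.H413.F0P2oDictionaryUpToCharacter

end
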